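import Summits.Ventures.CertifiedManyBodySolver.Upper.SuperSiteBlocking
import Literature.MathematicalPhysics.QuantumLattice.HubbardNNNHoppingOpenClusters

/-!
# The open Hubbard strip in column-major order, I: cells of `c` columns and their bonds

HONEST FRAMING: first certified bounds; not a superconductivity verdict; every number certified or
labelled float.

Venture `Ventures/CertifiedManyBodySolver` (sr-mbsolver), K1-GATE «writer (ii)» piece (α) of the route pen's
`WRITER-II-SPEC.md` (sr-mbsolver-var-7), STRIP PART 1/3 (generic part: `Upper/SuperSiteBlocking.lean`). The
producers of `a = ∞` strip-cell certificates (eng-1 `bd-strip-cell-v1`) and the sink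
`Theorems.m3Upper_tp0_le_m18o25_of_columnMajorSpinFamily` (`Theorems/R2cGcTangentConsumerSpin.lean`) use the
open `L × W` box `hubbardOpenBoxTT' L W t 0 U` on `Fin L ×ₗ Fin W` — COLUMN-MAJOR Jordan–Wigner order, site
`(x, y)`, `x` the column. This file blocks the `C·c` columns into `C` cells of `c` consecutive columns (cell
sites `Fin c ×ₗ Fin W`, an INTERVAL of the Jordan–Wigner order):

* `stripCells C c W : (Fin (C·c) ×ₗ Fin W) ≃ Fin C × (Fin c ×ₗ Fin W)` — cell `b`, cell position `(j, y)` ↔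
  site `(j + c·b, y)` (the cell embedding is `ThermodynamicLimit.stripEmb` up to `j + c·b = b·c + j`);
  `cellEmb C c W b` — cell `b` as an ORDER EMBEDDING with order-connected range
  (`ordConnected_range_cellEmb`), `stripCells_fst_of_between` (nothing lies between consecutive cells);
* `rectBoxGraph_adj_stripCells_symm_iff` — **the bonds of the big box, cell by cell**: a bond joins two
  sites of ONE cell adjacent in that cell's own `c × W` open box, or it is the horizontal bond
  `((c-1, y) of cell b) — ((0, y) of cell b+1)`;
* `sum_sum_ite_rectBoxGraph_adj_cells` — the corresponding splitting of sums over ordered bonds.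

Parts 2/3 (`Upper/StripCellWords.lean`: the inter-cell Jordan–Wigner words) and 3/3
(`Upper/StripCellHamiltonian.lean`: `superOp (toSpin H) = bondSum n (stripCellBondMatrix …) + last cell`)
build on this. References: route pen's `WRITER-II-SPEC.md` §1 (α); LeBlanc et al., PRX 5 (2015) 041041,
eq. (1) (the open-cluster model `hubbardOpenBoxTT'`); Essler et al. (2005) §12.3.4 (Jordan–Wigner order).
-/

noncomputable section

open Matrix Finset
open scoped ComplexOrder BigOperators Kronecker

namespace Summit.Ventures.CertifiedManyBodySolver.Upper

open Literature.MathematicalPhysics.QuantumLattice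
open Literature.MathematicalPhysics.QuantumLattice.JordanWigner

/-! ### The cell decomposition of the strip -/

section Cells

variable (C c W : ℕ)

/-- The cell decomposition of the `(C·c) × W` column-major box into `C` cells of `c` consecutive columns:
`(x, y) ↦ (x / c, (x % c, y))`, inverse `(b, (j, y)) ↦ (j + c·b, y)`. -/
def stripCells : (Fin (C * c) ×ₗ Fin W) ≃ Fin C × (Fin c ×ₗ Fin W) :=
  ofLex.trans <| (Equiv.prodCongr finProdFinEquiv.symm (Equiv.refl (Fin W))).trans <|
    (Equiv.prodAssoc (Fin C) (Fin c) (Fin W)).trans (Equiv.prodCongr (Equiv.refl (Fin C)) toLex)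

variable {C c W}

/-- The site of cell `b` at cell position `f = (j, y)` is `(j + c·b, y)`. -/
theorem stripCells_symm_apply (b : Fin C) (f : Fin c ×ₗ Fin W) :
    (stripCells C c W).symm (b, f) = toLex (finProdFinEquiv (b, (ofLex f).1), (ofLex f).2) := rfl

/-- The column of the site of cell `b` at cell position `(j, y)` is `j + c·b`. -/
@[simp] theorem stripCells_symm_fst_val (b : Fin C) (f : Fin c ×ₗ Fin W) :
    ((ofLex ((stripCells C c W).symm (b, f))).1 : ℕ) = ((ofLex f).1 : ℕ) + c * b := by
  rw [stripCells_symm_apply]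
  simp

/-- The row of the site of cell `b` at cell position `(j, y)` is `y`. -/
@[simp] theorem stripCells_symm_snd (b : Fin C) (f : Fin c ×ₗ Fin W) :
    (ofLex ((stripCells C c W).symm (b, f))).2 = (ofLex f).2 := rfl

/-- The cell of a site is read off its column: `c·b ≤ x < c·b + c`. -/
theorem stripCells_fst_bounds (x : Fin (C * c) ×ₗ Fin W) :
    c * ((stripCells C c W x).1 : ℕ) ≤ ((ofLex x).1 : ℕ) ∧
      ((ofLex x).1 : ℕ) < c * ((stripCells C c W x).1 : ℕ) + c := by
  obtain ⟨⟨b, f⟩, rfl⟩ := (stripCells C c W).symm.surjective x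
  simp only [Equiv.apply_symm_apply, stripCells_symm_fst_val]
  have := (ofLex f).1.isLt
  constructor <;> omega

/-- Cell indices are determined by column bounds. -/
theorem stripCells_fst_eq_of_bounds (x : Fin (C * c) ×ₗ Fin W) (b : Fin C)
    (h₁ : c * (b : ℕ) ≤ ((ofLex x).1 : ℕ)) (h₂ : ((ofLex x).1 : ℕ) < c * b + c) :
    (stripCells C c W x).1 = b := by
  obtain ⟨h₃, h₄⟩ := stripCells_fst_bounds x
  apply Fin.ext
  have h₅ : c * ((stripCells C c W x).1 : ℕ) < c * ((b : ℕ) + 1) := by rw [mul_add_one]; omega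
  have h₆ : c * (b : ℕ) < c * (((stripCells C c W x).1 : ℕ) + 1) := by rw [mul_add_one]; omega
  have h₇ := Nat.lt_of_mul_lt_mul_left h₅
  have h₈ := Nat.lt_of_mul_lt_mul_left h₆
  omega

/-- A site lies in the range of cell `b` iff its cell index is `b`. -/
theorem mem_range_stripCells_symm_iff (b : Fin C) (x : Fin (C * c) ×ₗ Fin W) :
    x ∈ Set.range (fun f => (stripCells C c W).symm (b, f)) ↔ (stripCells C c W x).1 = b := by
  constructor
  · rintro ⟨f, rfl⟩
    rw [Equiv.apply_symm_apply]
  · intro h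
    refine ⟨(stripCells C c W x).2, ?_⟩
    show (stripCells C c W).symm (b, (stripCells C c W x).2) = x
    rw [← h, Prod.mk.eta, Equiv.symm_apply_apply]

/-- The first coordinate is monotone in the lexicographic order. -/
theorem ofLex_fst_le_of_le {A : ℕ} {p q : Fin A ×ₗ Fin W} (h : p ≤ q) : (ofLex p).1 ≤ (ofLex q).1 := by
  rcases (Prod.Lex.toLex_le_toLex.mp (show toLex (ofLex p) ≤ toLex (ofLex q) from h)) with h' | h'
  · exact h'.le
  · exact h'.1.le

/-- Sites of one cell compare as their cell positions (the cell is embedded monotonically). -/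
theorem stripCells_symm_le_iff (b : Fin C) (f f' : Fin c ×ₗ Fin W) :
    (stripCells C c W).symm (b, f) ≤ (stripCells C c W).symm (b, f') ↔ f ≤ f' := by
  rw [stripCells_symm_apply, stripCells_symm_apply, Prod.Lex.toLex_le_toLex]
  conv_rhs => rw [← toLex_ofLex f, ← toLex_ofLex f', Prod.Lex.toLex_le_toLex]
  simp only [Fin.lt_def, Fin.le_def, Fin.ext_iff, finProdFinEquiv_apply_val]
  omega

variable (C c W) in
/-- **Cell `b` as an order embedding** `(Fin c ×ₗ Fin W) ↪o (Fin (C·c) ×ₗ Fin W)`, `f ↦ (stripCells C c W)⁻¹ (b, f)`. -/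
def cellEmb (b : Fin C) : (Fin c ×ₗ Fin W) ↪o (Fin (C * c) ×ₗ Fin W) :=
  OrderEmbedding.ofMapLEIff (fun f => (stripCells C c W).symm (b, f)) (stripCells_symm_le_iff b)

/-- `cellEmb C c W b f = (stripCells C c W)⁻¹ (b, f)`. -/
@[simp] theorem cellEmb_apply (b : Fin C) (f : Fin c ×ₗ Fin W) :
    cellEmb C c W b f = (stripCells C c W).symm (b, f) := rfl

/-- **Cells are intervals** of the column-major order. -/
theorem ordConnected_range_cellEmb (b : Fin C) : (Set.range (cellEmb C c W b)).OrdConnected := by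
  refine ⟨fun lo hlo hi hhi z hz => ?_⟩
  obtain ⟨f, rfl⟩ := hlo
  obtain ⟨f', rfl⟩ := hhi
  simp only [cellEmb_apply] at hz
  change z ∈ Set.range (fun f => (stripCells C c W).symm (b, f))
  rw [mem_range_stripCells_symm_iff]
  have h₁ := ofLex_fst_le_of_le hz.1
  have h₂ := ofLex_fst_le_of_le hz.2
  simp only [Fin.le_def, stripCells_symm_fst_val] at h₁ h₂
  have := (ofLex f').1.isLt
  exact stripCells_fst_eq_of_bounds z b (by omega) (by omega)

/-- **Between two consecutive cells lies nothing else**: a site between a site of cell `b` and a site of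
cell `b'`, `b + 1 = b'`, belongs to cell `b` or to cell `b'`. -/
theorem stripCells_fst_of_between {b b' : Fin C} (hbb' : (b : ℕ) + 1 = b') (f f' : Fin c ×ₗ Fin W)
    {z : Fin (C * c) ×ₗ Fin W} (h₁ : (stripCells C c W).symm (b, f) ≤ z)
    (h₂ : z ≤ (stripCells C c W).symm (b', f')) :
    (stripCells C c W z).1 = b ∨ (stripCells C c W z).1 = b' := by
  have h₃ := ofLex_fst_le_of_le h₁
  have h₄ := ofLex_fst_le_of_le h₂
  simp only [Fin.le_def, stripCells_symm_fst_val] at h₃ h₄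
  have h₅ : c * (b' : ℕ) = c * b + c := by rw [← hbb', mul_add_one]
  have := (ofLex f').1.isLt
  by_cases h₆ : ((ofLex z).1 : ℕ) < c * b + c
  · exact Or.inl (stripCells_fst_eq_of_bounds z b (by omega) h₆)
  · exact Or.inr (stripCells_fst_eq_of_bounds z b' (by omega) (by omega))

end Cells

/-! ### The bonds of the big box, cell by cell -/

section Bonds

variable {C c W : ℕ}

/-- The arithmetic of the cell offsets `c·b`, `c·b'` of two cells (products kept as atoms). -/
theorem cell_offset_facts {c : ℕ} (hc : 0 < c) (b b' : ℕ) :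
    (c * b = c * b' ↔ b = b') ∧ (c * b' = c * b + c ↔ b' = b + 1) ∧ (c * b = c * b' + c ↔ b = b' + 1) ∧
      (c * b + c ≤ c * b' ∨ c * b' + c ≤ c * b ∨ c * b = c * b') := by
  refine ⟨⟨fun h => Nat.eq_of_mul_eq_mul_left hc h, fun h => by rw [h]⟩, ?_, ?_, ?_⟩
  · rw [← mul_add_one]
    exact ⟨fun h => Nat.eq_of_mul_eq_mul_left hc h, fun h => by rw [h]⟩
  · rw [← mul_add_one]
    exact ⟨fun h => Nat.eq_of_mul_eq_mul_left hc h, fun h => by rw [h]⟩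
  · rcases lt_trichotomy b b' with h | h | h
    · left
      have : c * (b + 1) ≤ c * b' := Nat.mul_le_mul_left c h
      rwa [mul_add_one] at this
    · right; right; rw [h]
    · right; left
      have : c * (b' + 1) ≤ c * b := Nat.mul_le_mul_left c h
      rwa [mul_add_one] at this

/-- **The bonds of the `(C·c) × W` open box, cell by cell**: a nearest-neighbour bond joins two sites of
ONE cell that are adjacent in that cell's own `c × W` open box, or it is the horizontal bond between
`(c-1, y)` of cell `b` and `(0, y)` of cell `b + 1` (either orientation). -/
theorem rectBoxGraph_adj_stripCells_symm_iff (hc : 0 < c) (b b' : Fin C) (f f' : Fin c ×ₗ Fin W) :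
    (rectBoxGraph (C * c) W).Adj ((stripCells C c W).symm (b, f)) ((stripCells C c W).symm (b', f')) ↔
      (b = b' ∧ (rectBoxGraph c W).Adj f f') ∨
      ((b : ℕ) + 1 = b' ∧ (ofLex f).1 = ⟨c - 1, by omega⟩ ∧ (ofLex f').1 = ⟨0, hc⟩ ∧
          (ofLex f).2 = (ofLex f').2) ∨
      ((b' : ℕ) + 1 = b ∧ (ofLex f).1 = ⟨0, hc⟩ ∧ (ofLex f').1 = ⟨c - 1, by omega⟩ ∧
          (ofLex f).2 = (ofLex f').2) := by
  obtain ⟨f₁, f₂, f₃, f₄⟩ := cell_offset_facts hc (b : ℕ) (b' : ℕ)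
  have h₁ := (ofLex f).1.isLt
  have h₂ := (ofLex f').1.isLt
  simp only [rectBoxGraph, lineAdj, stripCells_symm_snd, Fin.ext_iff, stripCells_symm_fst_val]
  omega

end Bonds

/-! ### Splitting bond sums over cells -/

section BondSums

variable {C c W : ℕ} {M : Type*} [AddCommMonoid M]

/-- `if P ∨ Q ∨ R then v else 0` splits into three when the cases exclude each other. -/
theorem ite_or_or_eq_add {P Q R : Prop} [Decidable P] [Decidable Q] [Decidable R] (v : M)
    (hPQ : ¬ (P ∧ Q)) (hPR : ¬ (P ∧ R)) (hQR : ¬ (Q ∧ R)) :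
    (if P ∨ Q ∨ R then v else 0) = (if P then v else 0) + (if Q then v else 0) + (if R then v else 0) := by
  by_cases hP : P <;> by_cases hQ : Q <;> by_cases hR : R <;> simp_all

/-- The bond indicator of the big box at two cell sites, split into its three exclusive cases. -/
theorem ite_rectBoxGraph_adj_cells (hc : 0 < c) (b b' : Fin C) (f f' : Fin c ×ₗ Fin W) (v : M) :
    (if (rectBoxGraph (C * c) W).Adj ((stripCells C c W).symm (b, f)) ((stripCells C c W).symm (b', f'))
      then v else 0) =
      (if b = b' ∧ (rectBoxGraph c W).Adj f f' then v else 0) +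
      (if (b : ℕ) + 1 = b' ∧ (ofLex f).1 = ⟨c - 1, by omega⟩ ∧ (ofLex f').1 = ⟨0, hc⟩ ∧
          (ofLex f).2 = (ofLex f').2 then v else 0) +
      (if (b' : ℕ) + 1 = b ∧ (ofLex f).1 = ⟨0, hc⟩ ∧ (ofLex f').1 = ⟨c - 1, by omega⟩ ∧
          (ofLex f).2 = (ofLex f').2 then v else 0) := by
  rw [if_congr (rectBoxGraph_adj_stripCells_symm_iff hc b b' f f') rfl rfl]
  refine ite_or_or_eq_add v ?_ ?_ ?_
  · rintro ⟨⟨h₁, -⟩, h₂, -⟩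
    rw [Fin.ext_iff] at h₁
    omega
  · rintro ⟨⟨h₁, -⟩, h₂, -⟩
    rw [Fin.ext_iff] at h₁
    omega
  · rintro ⟨⟨h₁, -⟩, h₂, -⟩
    omega

/-- Pairs of cell sites in prescribed columns `j₀`, `j₁` and a common row: the sum runs over the rows. -/
theorem sum_ite_sum_ite_cols_eq (j₀ j₁ : Fin c) (G : (Fin c ×ₗ Fin W) → (Fin c ×ₗ Fin W) → M) :
    (∑ f : Fin c ×ₗ Fin W, if (ofLex f).1 = j₀ then
        ∑ f' : Fin c ×ₗ Fin W, if (ofLex f').1 = j₁ then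
          (if (ofLex f).2 = (ofLex f').2 then G f f' else 0) else 0 else 0) =
      ∑ y : Fin W, G (toLex (j₀, y)) (toLex (j₁, y)) := by
  have hre : ∀ g : (Fin c ×ₗ Fin W) → M, ∑ f, g f = ∑ j : Fin c, ∑ y : Fin W, g (toLex (j, y)) :=
    fun g => by rw [← Equiv.sum_comp (toLex : Fin c × Fin W ≃ (Fin c ×ₗ Fin W)), Fintype.sum_prod_type]
  simp only [hre, ofLex_toLex, Finset.sum_ite_irrel, Finset.sum_const_zero, Fintype.sum_ite_eq']
  refine Finset.sum_congr rfl fun y _ => ?_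
  rw [Finset.sum_eq_single y]
  · exact if_pos rfl
  · exact fun y' _ h => if_neg (Ne.symm h)
  · exact fun h => absurd (Finset.mem_univ y) h

/-- **Bond sums of the `(C·c) × W` open box, cell by cell**: a sum over the ordered nearest-neighbour
pairs of the big box is the sum over the cells of the same sum for the cell's own `c × W` open box, plus,
for every pair of consecutive cells `b + 1 = b'` and every row `y`, the two orientations of the bond
`((c-1, y) of b) — ((0, y) of b')`. -/
theorem sum_sum_ite_rectBoxGraph_adj_cells (hc : 0 < c)
    (F : (Fin (C * c) ×ₗ Fin W) → (Fin (C * c) ×ₗ Fin W) → M) :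
    (∑ p, ∑ q, if (rectBoxGraph (C * c) W).Adj p q then F p q else 0) =
      (∑ b : Fin C, ∑ f : Fin c ×ₗ Fin W, ∑ f' : Fin c ×ₗ Fin W,
          if (rectBoxGraph c W).Adj f f' then
            F ((stripCells C c W).symm (b, f)) ((stripCells C c W).symm (b, f')) else 0) +
      ∑ b : Fin C, ∑ b' : Fin C, if (b : ℕ) + 1 = b' then
          ∑ y : Fin W, (F ((stripCells C c W).symm (b, toLex (⟨c - 1, by omega⟩, y)))
              ((stripCells C c W).symm (b', toLex (⟨0, hc⟩, y))) +
            F ((stripCells C c W).symm (b', toLex (⟨0, hc⟩, y)))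
              ((stripCells C c W).symm (b, toLex (⟨c - 1, by omega⟩, y)))) else 0 := by
  set e := stripCells C c W with he
  have hre : ∀ g : (Fin (C * c) ×ₗ Fin W) → M, ∑ p, g p = ∑ b : Fin C, ∑ f : Fin c ×ₗ Fin W, g (e.symm (b, f)) :=
    fun g => by rw [← Equiv.sum_comp e.symm, Fintype.sum_prod_type]
  simp only [hre, he, ite_rectBoxGraph_adj_cells hc, Finset.sum_add_distrib]
  rw [← he]
  -- block 1: bonds inside one cell
  have h1 : (∑ b : Fin C, ∑ f : Fin c ×ₗ Fin W, ∑ b' : Fin C, ∑ f' : Fin c ×ₗ Fin W,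
      if b = b' ∧ (rectBoxGraph c W).Adj f f' then F (e.symm (b, f)) (e.symm (b', f')) else 0) =
      ∑ b : Fin C, ∑ f : Fin c ×ₗ Fin W, ∑ f' : Fin c ×ₗ Fin W,
        if (rectBoxGraph c W).Adj f f' then F (e.symm (b, f)) (e.symm (b, f')) else 0 := by
    refine Finset.sum_congr rfl fun b _ => Finset.sum_congr rfl fun f _ => ?_
    rw [Finset.sum_comm]
    simp only [ite_and, Fintype.sum_ite_eq]
  -- blocks 2 and 3: bonds between consecutive cells, the two orientations
  have h23 : ∀ (j₀ j₁ : Fin c) (rel : Fin C → Fin C → Prop) [DecidableRel rel],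
      (∑ b : Fin C, ∑ f : Fin c ×ₗ Fin W, ∑ b' : Fin C, ∑ f' : Fin c ×ₗ Fin W,
        if rel b b' ∧ (ofLex f).1 = j₀ ∧ (ofLex f').1 = j₁ ∧ (ofLex f).2 = (ofLex f').2 then
          F (e.symm (b, f)) (e.symm (b', f')) else 0) =
        ∑ b : Fin C, ∑ b' : Fin C, if rel b b' then
          ∑ y : Fin W, F (e.symm (b, toLex (j₀, y))) (e.symm (b', toLex (j₁, y))) else 0 := by
    intro j₀ j₁ rel _
    refine Finset.sum_congr rfl fun b _ => ?_
    rw [Finset.sum_comm]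
    refine Finset.sum_congr rfl fun b' _ => ?_
    simp only [ite_and, Finset.sum_ite_irrel, Finset.sum_const_zero]
    congr 1
    exact sum_ite_sum_ite_cols_eq j₀ j₁ _
  rw [h1, h23 ⟨c - 1, by omega⟩ ⟨0, hc⟩ (fun b b' : Fin C => (b : ℕ) + 1 = b'),
    h23 ⟨0, hc⟩ ⟨c - 1, by omega⟩ (fun b b' : Fin C => (b' : ℕ) + 1 = b),
    Finset.sum_comm (f := fun b b' : Fin C => if (b' : ℕ) + 1 = b then
      ∑ y : Fin W, F (e.symm (b, toLex (⟨0, hc⟩, y))) (e.symm (b', toLex (⟨c - 1, by omega⟩, y))) else 0),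
    add_assoc, ← Finset.sum_add_distrib]
  congr 1
  refine Finset.sum_congr rfl fun b _ => ?_
  rw [← Finset.sum_add_distrib]
  refine Finset.sum_congr rfl fun b' _ => ?_
  rw [ite_add_ite, add_zero, ← Finset.sum_add_distrib]

end BondSums

end Summit.Ventures.CertifiedManyBodySolver.Upper

end
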